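import Summits.Parity.BatemanHorn.Theorems.SoloInformedPairWindowMainTerm
import Summits.Parity.BatemanHorn.Theorems.SoloInformedPairWindowPsi

/-!
# Balanced pair window for the twin weight `μ(d₀)μ(d₁) log²(d₀d₁)` — the two pieces
# (soloist file, project (F)-kernel, L4a)

Soloist file (informed mode).  For the balanced divisor window of a pair of linear congruences with
the twin-prime divisor weight `μ(d₀) μ(d₁) log²(d₀ d₁)` on a square box `[1,B]²`:
* `abs_psi_logsq_le` — the sawtooth sums are `≤ 4 (48400 K_w + 144)(log x)⁶ x^{1−c}`
  (three applications of `abs_psi_le_gen` to the rescaled product weights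
  `(μ log²/log B) ⊗ (μ·log B)`, `μ log ⊗ μ log`, `(μ·log B) ⊗ (μ log²/log B)`);
* `abs_main_logsq_le` — the main-term double sum is
  `≤ τ(D)(1+log D)²(C₀+C₁+C₂)(4 log² x) 4^{ω(q₁)} (2 + 2 log x) 3⁴ (2/σ)⁸ (log x)^{-4}`
  (`abs_doubleSum_le_quad` with `u₀ = μ`, `α = log² d₀`, `β = 2 log d₀`, `γ = 1`). [folklore]
-/

namespace Summit.Parity.BatemanHorn.Theorems.PairWindow

open scoped BigOperators ArithmeticFunction.Moebius FourierTransform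
open Finset Real Filter Asymptotics
open Literature.NumberTheory.Sieve Literature.NumberTheory.Sieve.LinearPairMoebius
open Literature.NumberTheory.LFunctions.AFE (saw)

/-! ### The sawtooth sums for the twin weight -/

/-- `μ(d) f ≠ 0 ⇒ d` squarefree. [folklore] -/
theorem squarefree_of_moebius_mul_ne_zero {d : ℕ} {f : ℝ} (h : (μ d : ℝ) * f ≠ 0) :
    Squarefree d := by
  by_contra hs
  apply h
  rw [ArithmeticFunction.moebius_eq_zero_of_not_squarefree hs]
  simp

/-- `|a|, |b|, |c| ≤ R ⇒ |a + 2b + c| ≤ 4R`. [folklore] -/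
theorem abs_add_two_mul_add_le {a b c R : ℝ} (ha : |a| ≤ R) (hb : |b| ≤ R) (hc : |c| ≤ R) :
    |a + 2 * b + c| ≤ 4 * R := by
  calc |a + 2 * b + c| ≤ |a + 2 * b| + |c| := abs_add_le _ _
    _ ≤ |a| + |2 * b| + |c| := by gcongr; exact abs_add_le _ _
    _ = |a| + 2 * |b| + |c| := by rw [abs_mul, abs_two]
    _ ≤ R + 2 * R + R := by gcongr
    _ = 4 * R := by ring

/-- **Sawtooth sums of the balanced window, twin weight.**  Under the hypotheses of
`abs_psi_le_gen` with a square box `[1,B]²`, `x^{1−σ/2} ≤ B ≤ x²`: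
`|Σ_{d₀,d₁ ≤ B} [Sol(d)][window] μ(d₀)μ(d₁) log²(d₀d₁) ψ((y − ν_d)/lcm(d₀,d₁))|
   ≤ 4 (48400 K_w + 144)(log x)⁶ x^{1−c}`. [folklore] -/
theorem abs_psi_logsq_le {q₀ q₁ : ℕ} {a₀ a₁ : ℤ} {ε Kw : ℝ} (hKw0 : 0 ≤ Kw)
    (hKw : ∀ (σ θ η : ℝ) (x : ℕ), 0 < σ → 0 < θ → θ ≤ σ → θ ≤ 1 → 0 < η → η ≤ 1 →
      6 ≤ x → |(a₀ : ℝ)| ≤ x →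
      2 * ((((q₁ : ℤ) * a₀ - (q₀ : ℤ) * a₁).natAbs : ℕ) : ℝ) ≤ (x : ℝ) ^ σ →
      ∀ (X₀ X₁ : ℕ), (x : ℝ) ^ (1 + θ - σ) ≤ X₀ → (x : ℝ) ^ (1 + θ - σ) ≤ X₁ →
      ∀ (k : ℤ), k ≠ 0 → ∀ (y : ℝ), |y| ≤ x →
      ∀ (G₀ G₁ : ℝ), 0 ≤ G₀ → 0 ≤ G₁ → ∀ (v₀ v₁ : ℕ → ℂ), (∀ d, ‖v₀ d‖ ≤ G₀) →
      (∀ d, ‖v₁ d‖ ≤ G₁) → (∀ d, v₁ d ≠ 0 → Squarefree d) →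
      ∀ (ν : ℕ → ℕ → ℕ), (∀ d₀ d₁ : ℕ, 0 < d₀ → 0 < d₁ → Nat.Coprime d₀ q₀ → Nat.Coprime d₁ q₁ →
        ((Nat.gcd d₀ d₁ : ℕ) : ℤ) ∣ (q₁ : ℤ) * a₀ - (q₀ : ℤ) * a₁ →
          (d₀ : ℤ) ∣ (q₀ : ℤ) * (ν d₀ d₁) + a₀ ∧ (d₁ : ℤ) ∣ (q₁ : ℤ) * (ν d₀ d₁) + a₁) →
      ‖∑ d₀ ∈ Icc 1 X₀, ∑ d₁ ∈ Icc 1 X₁,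
          (if ((Nat.Coprime d₀ q₀ ∧ Nat.Coprime d₁ q₁ ∧
                ((Nat.gcd d₀ d₁ : ℕ) : ℤ) ∣ (q₁ : ℤ) * a₀ - (q₀ : ℤ) * a₁) ∧
              ((x : ℝ) ^ (1 - η) < (d₀ : ℝ) * d₁ ∧ (d₀ : ℝ) * d₁ ≤ (x : ℝ) ^ (1 + θ) ∧
                (x : ℝ) ^ σ < (d₀ : ℝ) ∧ (x : ℝ) ^ σ < (d₁ : ℝ))) then
            v₀ d₀ * v₁ d₁ * Complex.exp (2 * π * Complex.I *
              (((k : ℝ) * ((y - (ν d₀ d₁ : ℝ)) / ((Nat.lcm d₀ d₁ : ℕ) : ℝ)) : ℝ) : ℂ))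
          else 0)‖ ≤
        Kw * G₀ * G₁ * |(k : ℝ)| ^ (11 / 8 : ℝ) *
          (x : ℝ) ^ (η + (1 + θ) * (7 / 8) + (1 + θ - σ) * (11 / 48 + ε)) * Real.log x ^ 3)
    {σ θ η c : ℝ} (hσ : 0 < σ) (hσ1 : σ ≤ 1) (hc : 0 < c) (hcσ : c ≤ σ / 2) (hc2 : c ≤ 1 / 2)
    (hθ : 0 < θ) (hθc : θ ≤ c) (hη : 0 < η) (hηc : η ≤ c)
    (hexp : η + (1 + θ) * (7 / 8) + (1 + θ - σ) * (11 / 48 + ε) + (11 / 4) * c ≤ 1 - c)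
    {x : ℕ} (hx : 6 ≤ x) (ha₀ : |(a₀ : ℝ)| ≤ x)
    (h2D : 2 * ((((q₁ : ℤ) * a₀ - (q₀ : ℤ) * a₁).natAbs : ℕ) : ℝ) ≤ (x : ℝ) ^ σ)
    {B : ℕ} (hB : (x : ℝ) ^ (1 - σ / 2) ≤ B) (hB' : (B : ℝ) ≤ (x : ℝ) ^ 2)
    (ν : ℕ → ℕ → ℕ)
    (hν : ∀ d₀ d₁ : ℕ, 0 < d₀ → 0 < d₁ → Nat.Coprime d₀ q₀ → Nat.Coprime d₁ q₁ →
      ((Nat.gcd d₀ d₁ : ℕ) : ℤ) ∣ (q₁ : ℤ) * a₀ - (q₀ : ℤ) * a₁ →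
        (d₀ : ℤ) ∣ (q₀ : ℤ) * (ν d₀ d₁) + a₀ ∧ (d₁ : ℤ) ∣ (q₁ : ℤ) * (ν d₀ d₁) + a₁)
    {y : ℕ} (hy : y ≤ x) :
    |∑ d₀ ∈ Icc 1 B, ∑ d₁ ∈ Icc 1 B,
        (if (Nat.Coprime d₀ q₀ ∧ Nat.Coprime d₁ q₁ ∧
            ((Nat.gcd d₀ d₁ : ℕ) : ℤ) ∣ (q₁ : ℤ) * a₀ - (q₀ : ℤ) * a₁) then
          (if ((x : ℝ) ^ (1 - η) < (d₀ : ℝ) * d₁ ∧ (d₀ : ℝ) * d₁ ≤ (x : ℝ) ^ (1 + θ) ∧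
              (x : ℝ) ^ σ < (d₀ : ℝ) ∧ (x : ℝ) ^ σ < (d₁ : ℝ)) then
            (μ d₀ : ℝ) * (μ d₁ : ℝ) * Real.log ((d₀ : ℝ) * d₁) ^ 2 else 0) else 0) *
          saw (((y : ℝ) - ν d₀ d₁) / (Nat.lcm d₀ d₁ : ℕ))| ≤
      4 * ((48400 * Kw + 144) * Real.log x ^ 6 * (x : ℝ) ^ (1 - c)) := by
  classical
  -- `B ≥ 3`, `L = log B > 0`
  have hx6 : (6 : ℝ) ≤ x := by exact_mod_cast hx
  have hx1 : (1 : ℝ) ≤ x := by linarith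
  have hB3 : 3 ≤ B := by
    have h1 : (x : ℝ) ≤ (x : ℝ) ^ (2 - σ) := by
      conv_lhs => rw [← Real.rpow_one (x : ℝ)]
      exact Real.rpow_le_rpow_of_exponent_le hx1 (by linarith)
    have h2 : ((x : ℝ) ^ (1 - σ / 2)) ^ 2 = (x : ℝ) ^ (2 - σ) := by
      rw [← Real.rpow_natCast, ← Real.rpow_mul (by linarith)]; norm_num; ring_nf
    have h3 : (x : ℝ) ^ (2 - σ) ≤ (B : ℝ) ^ 2 := by
      rw [← h2]; exact pow_le_pow_left₀ (by positivity) hB 2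
    have h4 : (6 : ℝ) ≤ (B : ℝ) ^ 2 := by linarith
    by_contra hlt
    have : (B : ℝ) ≤ 2 := by exact_mod_cast (by omega : B ≤ 2)
    nlinarith
  have hB3R : (3 : ℝ) ≤ B := by exact_mod_cast hB3
  set L : ℝ := Real.log B with hLdef
  have hL : 0 < L := Real.log_pos (by linarith)
  -- the three weights
  set w₂ : ℕ → ℝ := fun d => (μ d : ℝ) * Real.log d ^ 2 / L with hw₂
  set wK : ℕ → ℝ := fun d => (μ d : ℝ) * L with hwK
  set w₁ : ℕ → ℝ := fun d => (μ d : ℝ) * Real.log d with hw₁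
  have hμ1 : ∀ d : ℕ, |(μ d : ℝ)| ≤ 1 := fun d => by
    exact_mod_cast ArithmeticFunction.abs_moebius_le_one
  have hlogd : ∀ d : ℕ, d ≤ B → 0 ≤ Real.log d ∧ Real.log d ≤ L := by
    intro d hd
    rcases Nat.eq_zero_or_pos d with rfl | hpos
    · simp [hL.le]
    · exact ⟨Real.log_nonneg (by exact_mod_cast hpos),
        Real.log_le_log (by exact_mod_cast hpos) (by exact_mod_cast hd)⟩
  have hb₂ : ∀ d, d ≤ B → |w₂ d| ≤ Real.log B := by
    intro d hd
    obtain ⟨h0, hle⟩ := hlogd d hd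
    simp only [hw₂]
    rw [abs_div, abs_mul, abs_of_pos hL, abs_of_nonneg (pow_nonneg h0 2), div_le_iff₀ hL]
    calc |(μ d : ℝ)| * Real.log d ^ 2 ≤ 1 * L ^ 2 :=
          mul_le_mul (hμ1 d) (pow_le_pow_left₀ h0 hle 2) (pow_nonneg h0 2) zero_le_one
      _ = Real.log B * L := by rw [hLdef]; ring
  have hbK : ∀ d, d ≤ B → |wK d| ≤ Real.log B := by
    intro d _
    simp only [hwK]
    rw [abs_mul, abs_of_pos hL]
    calc |(μ d : ℝ)| * L ≤ 1 * L := mul_le_mul_of_nonneg_right (hμ1 d) hL.le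
      _ = Real.log B := by rw [hLdef, one_mul]
  have hb₁ : ∀ d, d ≤ B → |w₁ d| ≤ Real.log B := by
    intro d hd
    obtain ⟨h0, hle⟩ := hlogd d hd
    simp only [hw₁]
    rw [abs_mul, abs_of_nonneg h0]
    calc |(μ d : ℝ)| * Real.log d ≤ 1 * L := mul_le_mul (hμ1 d) hle h0 zero_le_one
      _ = Real.log B := by rw [hLdef, one_mul]
  have hs₂ : ∀ d, w₂ d ≠ 0 → Squarefree d := fun d hd =>
    squarefree_of_moebius_mul_ne_zero (f := Real.log d ^ 2 / L) (by
      simp only [hw₂] at hd; rwa [mul_div_assoc] at hd)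
  have hsK : ∀ d, wK d ≠ 0 → Squarefree d := fun d hd =>
    squarefree_of_moebius_mul_ne_zero (f := L) (by simpa only [hwK] using hd)
  have hs₁ : ∀ d, w₁ d ≠ 0 → Squarefree d := fun d hd =>
    squarefree_of_moebius_mul_ne_zero (f := Real.log d) (by simpa only [hw₁] using hd)
  -- the three sawtooth bounds
  have hA := abs_psi_le_gen hKw0 hKw hσ hσ1 hc hcσ hc2 hθ hθc hη hηc hexp hx ha₀ h2D hB hB' hB hB'
    ν hν (w₀ := w₂) (w₁ := wK) hb₂ hbK hsK hy
  have hBB := abs_psi_le_gen hKw0 hKw hσ hσ1 hc hcσ hc2 hθ hθc hη hηc hexp hx ha₀ h2D hB hB' hB hB'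
    ν hν (w₀ := w₁) (w₁ := w₁) hb₁ hb₁ hs₁ hy
  have hC := abs_psi_le_gen hKw0 hKw hσ hσ1 hc hcσ hc2 hθ hθc hη hηc hexp hx ha₀ h2D hB hB' hB hB'
    ν hν (w₀ := wK) (w₁ := w₂) hbK hb₂ hs₂ hy
  -- pointwise splitting of the twin weight
  have hpt : ∀ d₀ ∈ Icc 1 B, ∀ d₁ ∈ Icc 1 B,
      (if (Nat.Coprime d₀ q₀ ∧ Nat.Coprime d₁ q₁ ∧
            ((Nat.gcd d₀ d₁ : ℕ) : ℤ) ∣ (q₁ : ℤ) * a₀ - (q₀ : ℤ) * a₁) then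
          (if ((x : ℝ) ^ (1 - η) < (d₀ : ℝ) * d₁ ∧ (d₀ : ℝ) * d₁ ≤ (x : ℝ) ^ (1 + θ) ∧
              (x : ℝ) ^ σ < (d₀ : ℝ) ∧ (x : ℝ) ^ σ < (d₁ : ℝ)) then
            (μ d₀ : ℝ) * (μ d₁ : ℝ) * Real.log ((d₀ : ℝ) * d₁) ^ 2 else 0) else 0) *
          saw (((y : ℝ) - ν d₀ d₁) / (Nat.lcm d₀ d₁ : ℕ)) =
        (if (Nat.Coprime d₀ q₀ ∧ Nat.Coprime d₁ q₁ ∧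
            ((Nat.gcd d₀ d₁ : ℕ) : ℤ) ∣ (q₁ : ℤ) * a₀ - (q₀ : ℤ) * a₁) then
          (if ((x : ℝ) ^ (1 - η) < (d₀ : ℝ) * d₁ ∧ (d₀ : ℝ) * d₁ ≤ (x : ℝ) ^ (1 + θ) ∧
              (x : ℝ) ^ σ < (d₀ : ℝ) ∧ (x : ℝ) ^ σ < (d₁ : ℝ)) then
            w₂ d₀ * wK d₁ else 0) else 0) *
          saw (((y : ℝ) - ν d₀ d₁) / (Nat.lcm d₀ d₁ : ℕ)) +
        2 * ((if (Nat.Coprime d₀ q₀ ∧ Nat.Coprime d₁ q₁ ∧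
            ((Nat.gcd d₀ d₁ : ℕ) : ℤ) ∣ (q₁ : ℤ) * a₀ - (q₀ : ℤ) * a₁) then
          (if ((x : ℝ) ^ (1 - η) < (d₀ : ℝ) * d₁ ∧ (d₀ : ℝ) * d₁ ≤ (x : ℝ) ^ (1 + θ) ∧
              (x : ℝ) ^ σ < (d₀ : ℝ) ∧ (x : ℝ) ^ σ < (d₁ : ℝ)) then
            w₁ d₀ * w₁ d₁ else 0) else 0) *
          saw (((y : ℝ) - ν d₀ d₁) / (Nat.lcm d₀ d₁ : ℕ))) +
        (if (Nat.Coprime d₀ q₀ ∧ Nat.Coprime d₁ q₁ ∧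
            ((Nat.gcd d₀ d₁ : ℕ) : ℤ) ∣ (q₁ : ℤ) * a₀ - (q₀ : ℤ) * a₁) then
          (if ((x : ℝ) ^ (1 - η) < (d₀ : ℝ) * d₁ ∧ (d₀ : ℝ) * d₁ ≤ (x : ℝ) ^ (1 + θ) ∧
              (x : ℝ) ^ σ < (d₀ : ℝ) ∧ (x : ℝ) ^ σ < (d₁ : ℝ)) then
            wK d₀ * w₂ d₁ else 0) else 0) *
          saw (((y : ℝ) - ν d₀ d₁) / (Nat.lcm d₀ d₁ : ℕ)) := by
    intro d₀ hd₀ d₁ hd₁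
    have h0 : (0 : ℝ) < d₀ := by exact_mod_cast (Finset.mem_Icc.1 hd₀).1
    have h1 : (0 : ℝ) < d₁ := by exact_mod_cast (Finset.mem_Icc.1 hd₁).1
    by_cases hs : (Nat.Coprime d₀ q₀ ∧ Nat.Coprime d₁ q₁ ∧
            ((Nat.gcd d₀ d₁ : ℕ) : ℤ) ∣ (q₁ : ℤ) * a₀ - (q₀ : ℤ) * a₁)
    · by_cases hw : ((x : ℝ) ^ (1 - η) < (d₀ : ℝ) * d₁ ∧ (d₀ : ℝ) * d₁ ≤ (x : ℝ) ^ (1 + θ) ∧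
              (x : ℝ) ^ σ < (d₀ : ℝ) ∧ (x : ℝ) ^ σ < (d₁ : ℝ))
      · simp only [if_pos hs, if_pos hw, hw₂, hwK, hw₁]
        rw [Real.log_mul h0.ne' h1.ne']
        field_simp
        ring
      · simp only [if_pos hs, if_neg hw]; ring
    · simp only [if_neg hs]; ring
  rw [Finset.sum_congr rfl fun d₀ hd₀ => Finset.sum_congr rfl fun d₁ hd₁ => hpt d₀ hd₀ d₁ hd₁]
  simp only [Finset.sum_add_distrib, ← Finset.mul_sum]
  exact abs_add_two_mul_add_le hA hBB hC

/-! ### The main term for the twin weight -/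

/-- **Main-term double sum of the balanced window, twin weight.**  For `q₁ ≥ 1`, `Δ ≠ 0`,
Siegel–Walfisz-strength constants `C₀, C₁, C₂` (exponent `8`), `σ > 0`, `x ≥ 3` with `2D ≤ x^σ`,
`D ≤ x^{σ/2}`, and a box side `B ≤ x²`:
`|Σ_{d₀,d₁ ≤ B} [Sol(d)][window] μ(d₀)μ(d₁) log²(d₀d₁)/lcm(d₀,d₁)|
   ≤ τ(D)(1+log D)²(C₀+C₁+C₂)(4 log² x) 4^{ω(q₁)} (2 + 2 log x) 3⁴ (2/σ)⁸/(log x)⁴`. [folklore] -/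
theorem abs_main_logsq_le (q₀ : ℕ) {q₁ : ℕ} (hq₁ : 0 < q₁) {a₀ a₁ : ℤ}
    (hΔ : (q₁ : ℤ) * a₀ - (q₀ : ℤ) * a₁ ≠ 0)
    {C₀ C₁ C₂ : ℝ} (hC₀0 : 0 ≤ C₀) (hC₁0 : 0 ≤ C₁) (hC₂0 : 0 ≤ C₂)
    (hC₀ : ∀ q : ℕ, q ≠ 0 → ∀ A W : ℝ, 2 ≤ A → A ≤ W →
      |∑ n ∈ (Ioc ⌊A⌋₊ ⌊W⌋₊).filter (fun n : ℕ => n.Coprime q), (μ n : ℝ) / n| ≤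
        C₀ * (4 : ℝ) ^ q.primeFactors.card / Real.log A ^ (8 : ℝ))
    (hC₁ : ∀ q : ℕ, q ≠ 0 → ∀ A W : ℝ, 2 ≤ A → A ≤ W →
      |∑ n ∈ (Ioc ⌊A⌋₊ ⌊W⌋₊).filter (fun n : ℕ => n.Coprime q), (μ n : ℝ) * Real.log n / n| ≤
        C₁ * (4 : ℝ) ^ q.primeFactors.card / Real.log A ^ (8 : ℝ))
    (hC₂ : ∀ q : ℕ, q ≠ 0 → ∀ A W : ℝ, 2 ≤ A → A ≤ W →
      |∑ n ∈ (Ioc ⌊A⌋₊ ⌊W⌋₊).filter (fun n : ℕ => n.Coprime q),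
          (μ n : ℝ) * Real.log n ^ 2 / n| ≤
        C₂ * (4 : ℝ) ^ q.primeFactors.card * (2 + Real.log W) / Real.log A ^ (8 : ℝ))
    {σ : ℝ} (hσ : 0 < σ) (θ η : ℝ) {x : ℕ} (hx₃ : 3 ≤ x)
    (hx₁ : 2 * ((((q₁ : ℤ) * a₀ - (q₀ : ℤ) * a₁).natAbs : ℕ) : ℝ) ≤ (x : ℝ) ^ σ)
    (hx₂ : ((((q₁ : ℤ) * a₀ - (q₀ : ℤ) * a₁).natAbs : ℕ) : ℝ) ≤ (x : ℝ) ^ (σ / 2))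
    {B : ℕ} (hB' : (B : ℝ) ≤ (x : ℝ) ^ 2) :
    |∑ d₀ ∈ Icc 1 B, ∑ d₁ ∈ Icc 1 B,
        (if (Nat.Coprime d₀ q₀ ∧ Nat.Coprime d₁ q₁ ∧
            ((Nat.gcd d₀ d₁ : ℕ) : ℤ) ∣ (q₁ : ℤ) * a₀ - (q₀ : ℤ) * a₁) then
          (if ((x : ℝ) ^ (1 - η) < (d₀ : ℝ) * d₁ ∧ (d₀ : ℝ) * d₁ ≤ (x : ℝ) ^ (1 + θ) ∧
              (x : ℝ) ^ σ < (d₀ : ℝ) ∧ (x : ℝ) ^ σ < (d₁ : ℝ)) then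
            (μ d₀ : ℝ) * (μ d₁ : ℝ) * Real.log ((d₀ : ℝ) * d₁) ^ 2 else 0) else 0) /
          (Nat.lcm d₀ d₁ : ℕ)| ≤
      1 * ((((q₁ : ℤ) * a₀ - (q₀ : ℤ) * a₁).natAbs.divisors.card : ℝ) *
        (1 + Real.log (((q₁ : ℤ) * a₀ - (q₀ : ℤ) * a₁).natAbs : ℕ)) ^ 2 * (C₀ + C₁ + C₂) *
          (4 * Real.log x ^ 2) * (4 : ℝ) ^ q₁.primeFactors.card) * (2 + 2 * Real.log x) * 3 ^ 4 *
            (2 / σ) ^ (8 : ℝ) / Real.log x ^ 4 := by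
  classical
  set Δ : ℤ := (q₁ : ℤ) * a₀ - (q₀ : ℤ) * a₁ with hΔdef
  have hx3 : (3 : ℝ) ≤ x := by exact_mod_cast hx₃
  have hx0 : (0 : ℝ) < x := by linarith
  have hL1 : 1 ≤ Real.log x := by
    rw [Real.le_log_iff_exp_le hx0]
    have := Real.exp_one_lt_d9; linarith
  have hlogx2 : Real.log ((x : ℝ) ^ 2) = 2 * Real.log x := by
    rw [show ((x : ℝ) ^ 2) = (x : ℝ) ^ (2 : ℝ) by norm_cast, Real.log_rpow hx0]
  have hlogd : ∀ d : ℕ, 1 ≤ d → d ≤ B → 0 ≤ Real.log d ∧ Real.log d ≤ 2 * Real.log x := by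
    intro d hd hdB
    refine ⟨Real.log_nonneg (by exact_mod_cast hd), ?_⟩
    rcases Nat.eq_zero_or_pos B with hB0 | hBpos
    · omega
    · calc Real.log d ≤ Real.log B :=
            Real.log_le_log (by exact_mod_cast hd) (by exact_mod_cast hdB)
        _ ≤ 2 * Real.log x := by
            rw [← hlogx2]; exact Real.log_le_log (by exact_mod_cast hBpos) hB'
  -- the summand in the form of `abs_doubleSum_le_quad`
  have hrw : ∀ d₀ ∈ Icc 1 B, ∀ d₁ ∈ Icc 1 B,
      (if (Nat.Coprime d₀ q₀ ∧ Nat.Coprime d₁ q₁ ∧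
            ((Nat.gcd d₀ d₁ : ℕ) : ℤ) ∣ (q₁ : ℤ) * a₀ - (q₀ : ℤ) * a₁) then
          (if ((x : ℝ) ^ (1 - η) < (d₀ : ℝ) * d₁ ∧ (d₀ : ℝ) * d₁ ≤ (x : ℝ) ^ (1 + θ) ∧
              (x : ℝ) ^ σ < (d₀ : ℝ) ∧ (x : ℝ) ^ σ < (d₁ : ℝ)) then
            (μ d₀ : ℝ) * (μ d₁ : ℝ) * Real.log ((d₀ : ℝ) * d₁) ^ 2 else 0) else 0) /
          (Nat.lcm d₀ d₁ : ℕ) =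
        (μ d₀ : ℝ) / d₀ * ((if Nat.Coprime d₀ q₀ then (1 : ℝ) else 0) *
          (if ((x : ℝ) ^ (1 - η) < (d₀ : ℝ) * d₁ ∧ (d₀ : ℝ) * d₁ ≤ (x : ℝ) ^ (1 + θ) ∧
              (x : ℝ) ^ σ < (d₀ : ℝ) ∧ (x : ℝ) ^ σ < (d₁ : ℝ)) then
            (if Nat.Coprime d₁ q₁ ∧ ((Nat.gcd d₀ d₁ : ℕ) : ℤ) ∣ Δ then
              (μ d₁ : ℝ) * (Real.log d₀ ^ 2 + 2 * Real.log d₀ * Real.log d₁ +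
                1 * Real.log d₁ ^ 2) * ((Nat.gcd d₀ d₁ : ℝ) / d₁) else 0) else 0)) := by
    intro d₀ hd₀ d₁ hd₁
    have h0 : 0 < d₀ := (Finset.mem_Icc.1 hd₀).1
    have h1 : 0 < d₁ := (Finset.mem_Icc.1 hd₁).1
    have h0R : (0 : ℝ) < d₀ := by exact_mod_cast h0
    have h1R : (0 : ℝ) < d₁ := by exact_mod_cast h1
    have hwt : (if ((x : ℝ) ^ (1 - η) < (d₀ : ℝ) * d₁ ∧ (d₀ : ℝ) * d₁ ≤ (x : ℝ) ^ (1 + θ) ∧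
              (x : ℝ) ^ σ < (d₀ : ℝ) ∧ (x : ℝ) ^ σ < (d₁ : ℝ)) then
            (μ d₀ : ℝ) * (μ d₁ : ℝ) * Real.log ((d₀ : ℝ) * d₁) ^ 2 else 0) =
        (if ((x : ℝ) ^ (1 - η) < (d₀ : ℝ) * d₁ ∧ (d₀ : ℝ) * d₁ ≤ (x : ℝ) ^ (1 + θ) ∧
              (x : ℝ) ^ σ < (d₀ : ℝ) ∧ (x : ℝ) ^ σ < (d₁ : ℝ)) then
            (μ d₀ : ℝ) * ((μ d₁ : ℝ) * (Real.log d₀ ^ 2 + 2 * Real.log d₀ * Real.log d₁ +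
              1 * Real.log d₁ ^ 2)) else 0) := by
      split_ifs
      · rw [Real.log_mul h0R.ne' h1R.ne']; ring
      · rfl
    rw [hwt]
    exact mainTerm_summand_eq_gen Δ σ θ η (x : ℝ) (fun d => (μ d : ℝ))
      (fun d₀ d₁ => (μ d₁ : ℝ) * (Real.log d₀ ^ 2 + 2 * Real.log d₀ * Real.log d₁ +
        1 * Real.log d₁ ^ 2)) h0 h1
  rw [Finset.sum_congr rfl fun d₀ hd₀ => Finset.sum_congr rfl fun d₁ hd₁ => hrw d₀ hd₀ d₁ hd₁]
  have hu₀ : ∀ d : ℕ, 1 ≤ d → d ≤ B → |(μ d : ℝ)| ≤ 1 := fun d _ _ => by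
    exact_mod_cast ArithmeticFunction.abs_moebius_le_one
  have hΛ : (0 : ℝ) ≤ 4 * Real.log x ^ 2 := by positivity
  have hα : ∀ d : ℕ, 1 ≤ d → d ≤ B → |Real.log d ^ 2| ≤ 4 * Real.log x ^ 2 := by
    intro d hd hdB
    obtain ⟨h0, hle⟩ := hlogd d hd hdB
    rw [abs_of_nonneg (pow_nonneg h0 2)]
    nlinarith
  have hβ : ∀ d : ℕ, 1 ≤ d → d ≤ B → |2 * Real.log d| ≤ 4 * Real.log x ^ 2 := by
    intro d hd hdB
    obtain ⟨h0, hle⟩ := hlogd d hd hdB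
    rw [abs_of_nonneg (by linarith)]
    nlinarith
  have hγ : ∀ d : ℕ, 1 ≤ d → d ≤ B → |(1 : ℝ)| ≤ 4 * Real.log x ^ 2 := by
    intro d _ _
    rw [abs_one]; nlinarith
  exact abs_doubleSum_le_quad q₀ hq₁ hΔ hC₀0 hC₁0 hC₂0 hC₀ hC₁ hC₂ (u₀ := fun d => (μ d : ℝ))
    (G₀ := 1) zero_le_one (B₀ := B) hu₀ (α := fun d => Real.log d ^ 2)
    (β := fun d => 2 * Real.log d) (γ := fun _ => (1 : ℝ)) (Λ := 4 * Real.log x ^ 2) hΛ hα hβ hγ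
    hσ θ η hx₃ hx₁ hx₂ hB' hB'

end Summit.Parity.BatemanHorn.Theorems.PairWindow
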